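import Summits.HodgeConjecture.HodgeConjecture.Theses.SparseFermatTropicalDeficiency

/-!
# Birth skeleton (BC3) — crux `InvariantClassesAreHodge` (K4) of route `SparseFermatTropicalDeficiency`

Registrar seat `planner-skel-stmt-HodgeConjecture-18620-0` (2026-08-17). Crux decl
`Summit.HodgeConjecture.HodgeConjecture.Theses.SparseFermatTropicalDeficiency.InvariantClassesAreHodge`
(item `stmt-HodgeConjecture-18620`, rank 4): for a PURE sparse Fermat datum `𝔇 = (p, d, B)` and any `c`
with `X_c` smooth projective of dimension `2p` there are `m(𝔇) = invariantRank` classes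
`e_i ∈ H^{2p}(X_c(ℂ); ℂ)` that are rational, of Hodge type `(p,p)` and fixed by the `A_B`-averaging
projector `π = 𝔇.proj c`, such that every family `x` whose invariant projections `π x_a` span a space
containing all `e_i` has `cupRank ≥ m(𝔇)`.

## The cut (Shioda 1979 + equivariant Poincaré duality), three stubs

* `stub_invariantRationalBasis` — **InvariantRationalBasis** (topology + arithmetic, no Hodge theory;
  size L): for every datum and every smooth member `X_c`, the invariant subspace
  `range π = H^{2p}(X_c)^{A_B}` has a basis of `m(𝔇)` RATIONAL classes — Shioda's character count for
  the Fermat member `c = 0` (`dim (H^{2p})^{A_B} = 1 + #(𝔄 ∩ Λ_B)`: Shioda, Math. Ann. 245 (1979)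
  Thm. I; PJA 55A (1979) §4; in the tree `Ran1980_fermatEigenspace_le_span_holds`,
  `fermatEigenspace_eq_bot_of_sum_ne_zero`, `isInternal_fermatEigenspace`) transported along the
  `A_B`-equivariant local system over the (connected) smooth locus of the family
  (`universalHypersurfaceLocalSystem`, `…_transport_cupProduct`), plus rationality of
  `π = |A_B|⁻¹ Σ_a g_a^*` (`IsRationalClass.diagonalMap`, `span_isRationalClass_eq_top_of_isSmoothProjective_holds`,
  `finite_complexBetti_of_isSmoothProjective`, `range_eigenProjector`).
* `stub_invariantOfHodgeType` — **InvariantOfHodgeType** (Hodge theory; size M–L): for a PURE datum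
  every `π`-fixed class of a smooth member is of type `(p,p)` — at `c = 0` by Shioda's Hodge types of
  the eigenlines (`Ran1980_fermatEigenspace_hodgeType_pp_of_isHodge`), for general smooth `c` by
  constancy of the Hodge numbers of the invariant sub-variation over the connected smooth locus
  (Katz 2009 Lemma 3.1; stability `IsOfHodgeType.eigenProjector` in `DiagonalSymmetryStability`).
* `stub_invariantCupPerfect` — **InvariantCupPerfect** (duality; size M): the cup product restricted to
  `range π` has rank `≥ dim range π` — Poincaré duality on the closed oriented `4p`-manifold `X_c(ℂ)`
  (`bijective_poincareDualityMap_of_isSmoothProjective`, Hatcher Thm. 3.30 / Prop. 3.38) and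
  `w ∪ π w' = |A_B|⁻¹ Σ_a g_a^*(w ∪ w')` for invariant `w`, each `g_a^*` acting trivially on `H^{4p}`.

`InvariantClassesAreHodge_of` (kernel-checked, no sorry): `e` := the rational basis; `π e_i = e_i` by
`eigenProjector_idem`; Hodge type by stub 2; for the rank clause the span `V` of the `π x_a` satisfies
`range π = span e ≤ V ≤ range π`, so `m = finrank (span e) = finrank (range π) ≤ cupRank (range π) =
cupRank V`.

BC3 probes (folder `bc/probe_S{1,2,3}.lean`, battery `first | exact? | simpa [S] | (unfold; simpa) |
aesop`, 400000 heartbeats): `Sᵢ → InvariantClassesAreHodge`, `Sᵢ → HodgeConjecture`,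
`Sᵢ → ¬HodgeConjecture` all FAIL (rc 1, unsolved goals) for `i = 1, 2, 3`.
-/

namespace Summit.HodgeConjecture.HodgeConjecture.Cruxes.InvariantClassesAreHodge.Birth

open Literature.AlgebraicGeometry.HodgeTheory Literature.AlgebraicGeometry.Motives
open Summit.HodgeConjecture.HodgeConjecture.Theses.SparseFermatTropicalDeficiency

/-! ## §1 The stub statements -/

/-- **Stub 1 statement (Shioda's invariant count, rational form).** For every sparse Fermat datum `𝔇`
and every `c` with `X_c` smooth projective of dimension `2p`, the `A_B`-invariant subspace
`range (𝔇.proj c) ⊆ H^{2p}(X_c(ℂ); ℂ)` has a `ℂ`-basis of `invariantRank 𝔇 = 1 + #(𝔄 ∩ Λ_B)`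
rational classes. [cite: Shioda1979HodgeFermat, Thm. I] [cite: Shioda1979PJA, §4] -/
def InvariantRationalBasis : Prop :=
  ∀ (𝔇 : SparseFermat.Datum) (c : ↥𝔇.B → ℂ),
    IsSmoothProjective (2 * 𝔇.p) (𝔇.variety c) →
    ∃ e : Fin 𝔇.invariantRank → complexBetti (𝔇.variety c) (2 * 𝔇.p),
      LinearIndependent ℂ e ∧ (∀ i, IsRationalClass (e i)) ∧
      Submodule.span ℂ (Set.range e) = LinearMap.range (𝔇.proj c)

/-- **Stub 2 statement (purity ⇒ type `(p,p)`).** For a PURE datum `𝔇` and every `c` with `X_c`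
smooth projective of dimension `2p`, every class fixed by the invariant projector `𝔇.proj c` is of
Hodge type `(p,p)`. [cite: Shioda1979PJA, §1 eq. (2) and §4] [cite: Katz2009, §3 Lemma 3.1] -/
def InvariantOfHodgeType : Prop :=
  ∀ (𝔇 : SparseFermat.Datum), 𝔇.IsPure → ∀ (c : ↥𝔇.B → ℂ),
    IsSmoothProjective (2 * 𝔇.p) (𝔇.variety c) →
    ∀ y : complexBetti (𝔇.variety c) (2 * 𝔇.p), 𝔇.proj c y = y →
      IsOfHodgeType (2 * 𝔇.p) (𝔇.variety c) (2 * 𝔇.p) 𝔇.p 𝔇.p y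

/-- **Stub 3 statement (cup product perfect on the invariant part).** For every datum `𝔇` and every
`c` with `X_c` smooth projective of dimension `2p`, the cup product
`range π × range π → H^{4p}(X_c(ℂ); ℂ)` has rank at least `dim range π` (equivariant Poincaré duality
in the middle degree). [cite: HatcherAT2002, §3.3 Thm. 3.30 and Prop. 3.38]
[cite: Shioda1979HodgeFermat, §1] -/
def InvariantCupPerfect : Prop :=
  ∀ (𝔇 : SparseFermat.Datum) (c : ↥𝔇.B → ℂ),
    IsSmoothProjective (2 * 𝔇.p) (𝔇.variety c) →
    Module.finrank ℂ ↥(LinearMap.range (𝔇.proj c)) ≤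
      cupRank (𝔇.variety c) (2 * 𝔇.p) (LinearMap.range (𝔇.proj c))

/-! ## §2 The stubs (the ONLY `sorry`s of this file) -/

/-- STUB 1 (registered): `InvariantRationalBasis` — Shioda's count of the `A_B`-invariants transported
over the smooth locus, with a rational basis. [cite: Shioda1979HodgeFermat, Thm. I] -/
theorem stub_invariantRationalBasis : InvariantRationalBasis := by
  sorry

/-- STUB 2 (registered): `InvariantOfHodgeType` — purity puts every invariant class of a smooth member
in `H^{p,p}`. [cite: Shioda1979PJA, §1 eq. (2) and §4] -/
theorem stub_invariantOfHodgeType : InvariantOfHodgeType := by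
  sorry

/-- STUB 3 (registered): `InvariantCupPerfect` — the cup product is non-degenerate on the invariant
part of the middle cohomology. [cite: HatcherAT2002, §3.3 Thm. 3.30 and Prop. 3.38] -/
theorem stub_invariantCupPerfect : InvariantCupPerfect := by
  sorry

/-! ### Name-keyed aliases (the skeleton audit admits a hypothesis of `InvariantClassesAreHodge_of` iff
the head constant of its type has the short name of a declared stub) -/
namespace Registered

/-- Alias of `InvariantRationalBasis` keyed by the registered stub name. -/
abbrev stub_invariantRationalBasis : Prop := InvariantRationalBasis
/-- Alias of `InvariantOfHodgeType` keyed by the registered stub name. -/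
abbrev stub_invariantOfHodgeType : Prop := InvariantOfHodgeType
/-- Alias of `InvariantCupPerfect` keyed by the registered stub name. -/
abbrev stub_invariantCupPerfect : Prop := InvariantCupPerfect

end Registered

/-! ## §3 Composition (no `sorry` below this line) -/

/-- **The three stubs imply the crux, BY NAME.** `e` := the rational basis of `range π` (stub 1);
`π e_i = e_i` by idempotence of the isotypic projector; type `(p,p)` by stub 2; for a family `x` whose
invariant projections span `V ∋ e_i`: `range π = span e ≤ V ≤ range π`, so
`m = finrank (span e) = finrank (range π) ≤ cupRank (range π) = cupRank V` (stub 3).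
[cite: Shioda1979HodgeFermat, Thm. I] -/
theorem InvariantClassesAreHodge_of (h₁ : Registered.stub_invariantRationalBasis)
    (h₂ : Registered.stub_invariantOfHodgeType) (h₃ : Registered.stub_invariantCupPerfect) :
    Summit.HodgeConjecture.HodgeConjecture.Theses.SparseFermatTropicalDeficiency.InvariantClassesAreHodge := by
  intro 𝔇 hpure c hX
  obtain ⟨e, hli, hrat, hspan⟩ := h₁ 𝔇 c hX
  -- every `e i` is invariant, hence fixed by the (idempotent) projector
  have hmem : ∀ i, e i ∈ LinearMap.range (𝔇.proj c) := fun i ↦ by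
    rw [← hspan]
    exact Submodule.subset_span ⟨i, rfl⟩
  have hfix : ∀ i, 𝔇.proj c (e i) = e i := fun i ↦ by
    obtain ⟨y, hy⟩ := hmem i
    rw [← hy]
    exact eigenProjector_idem (𝔇.form c) (𝔇.group_le_diagonalStabilizer c) y
  refine ⟨e, fun i ↦ ⟨hrat i, h₂ 𝔇 hpure c hX (e i) (hfix i), hfix i⟩, fun ι x hx ↦ ?_⟩
  -- the span `V` of the invariant projections squeezes to `range π`
  have hVle : Submodule.span ℂ (Set.range fun a ↦ 𝔇.proj c (x a)) ≤ LinearMap.range (𝔇.proj c) :=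
    Submodule.span_le.mpr (by rintro _ ⟨a, rfl⟩; exact LinearMap.mem_range_self _ _)
  have hleV : LinearMap.range (𝔇.proj c) ≤ Submodule.span ℂ (Set.range fun a ↦ 𝔇.proj c (x a)) := by
    rw [← hspan]
    exact Submodule.span_le.mpr (by rintro _ ⟨i, rfl⟩; exact hx i)
  have hVeq : Submodule.span ℂ (Set.range fun a ↦ 𝔇.proj c (x a)) = LinearMap.range (𝔇.proj c) :=
    le_antisymm hVle hleV
  have hcard : Module.finrank ℂ ↥(Submodule.span ℂ (Set.range e)) = 𝔇.invariantRank := by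
    rw [finrank_span_eq_card hli, Fintype.card_fin]
  calc 𝔇.invariantRank = Module.finrank ℂ ↥(LinearMap.range (𝔇.proj c)) := by rw [← hcard, hspan]
    _ ≤ cupRank (𝔇.variety c) (2 * 𝔇.p) (LinearMap.range (𝔇.proj c)) := h₃ 𝔇 c hX
    _ = cupRank (𝔇.variety c) (2 * 𝔇.p) (Submodule.span ℂ (Set.range fun a ↦ 𝔇.proj c (x a))) := by
      rw [hVeq]

/-- **The skeleton theorem, closed form**: the crux from the three registered stubs (wiring check;
depends on the stubs' `sorry`s only through their names). [cite: Shioda1979HodgeFermat, Thm. I] -/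
theorem InvariantClassesAreHodge_of_stubs :
    Summit.HodgeConjecture.HodgeConjecture.Theses.SparseFermatTropicalDeficiency.InvariantClassesAreHodge :=
  InvariantClassesAreHodge_of stub_invariantRationalBasis stub_invariantOfHodgeType
    stub_invariantCupPerfect

end Summit.HodgeConjecture.HodgeConjecture.Cruxes.InvariantClassesAreHodge.Birth
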